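import Literature.NumberTheory.GelbartRogawski1991.LocalDoubledUnitaryDatum
import Literature.NumberTheory.GelbartRogawski1991.UnitaryDualPairGramDiagonalCM
import HarnessLib

/-!
# The doubled Gram matrix `T^𝔻 = T ⊕ (−T)` of a product of DIAGONAL forms is diagonal, with non-zero entries

Topic `NumberTheory/GelbartRogawski1991`; namespace `Literature.NumberTheory.GelbartRogawski1991.UnitaryDualPair`
(sequel of `UnitaryDualPairGramDiagonal` ∕ `UnitaryDualPairGramDiagonalCM` — the UNDOUBLED pin `gram = diag t₀`,
`t₀ = cmGramEntry` — and of `LocalDoubledUnitaryDatum` (`LocalSplitting.gramD`, `LocalSplitting.e₂`)).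
THEOREMS ONLY (no definition, no named fact, no `sorry`).

* `gramD_diagonal` — `gramD F n (diag t) = reindex e₂ e₂ (diag t ⊕ (−diag t)) = diag (t ⊕ (−t) ∘ e₂⁻¹)` over any field;
* `gramD_gram_diagonal` — closed form of the doubled Gram matrix of `(diag a, diag b)`;
* `gramD_gram_realDiagonal` — at the diagonal CM pin (`T_V = realDiagonal L dV`, `T_W = realDiagonal L dW`,
  [GelbartRogawski1991, §3.1 p. 454]; doubling [HarrisKudlaSweet1996, §1 (1.9)]):
  `T^𝔻 = diag (t₀ ⊕ (−t₀) ∘ e₂⁻¹)` with `t₀ = cmGramEntry L e dV dW`;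
* `gramD_gram_realDiagonal_entry_ne_zero` — those entries are non-zero when all `dV i, dW j ≠ 0`;
* `gramD_gram_realDiagonal_entry_coe` — their values in `L`: `± dV_{(e⁻¹i).1} · dW_{(e⁻¹i).2}`.

## Use

These are the inputs `(t₀, hTd : T = diagonal t₀, ht0 : ∀ k, t₀ k ≠ 0)` at `T := T^𝔻` of the archimedean
Weil-representation files written in a diagonal frame (`ArchFollandTorusAdelic.archMat_diagonal`; the archimedean
unitary Weil half of the [GR91 Prop. 3.1.1] construction), with `t₀^𝔻 := (cmGramEntry ⊕ (−cmGramEntry)) ∘ e₂⁻¹`.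

## References

* S. Gelbart, J. Rogawski, Invent. Math. 105 (1991), §3.1 p. 454 [GelbartRogawski1991].
* M. Harris, S. S. Kudla, W. J. Sweet, J. Amer. Math. Soc. 9 (1996), §1 (1.9) [HarrisKudlaSweet1996].
-/

set_option autoImplicit false

noncomputable section

open NumberField Matrix

namespace Literature.NumberTheory.GelbartRogawski1991.UnitaryDualPair

/-! ## §1. Over a general field -/

section General

variable (F : Type) [Field F] {N M n : ℕ} (e : Fin N × Fin M ≃ Fin n)

/-- `T^𝔻 = reindex e₂ e₂ (diag t ⊕ (−diag t)) = diag (t ⊕ (−t) ∘ e₂⁻¹)`: the doubled Gram matrix of a diagonal form is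
diagonal. [cite: HarrisKudlaSweet1996, §1 (1.9)] -/
theorem gramD_diagonal (t : Fin n → F) :
    LocalSplitting.gramD F n (Matrix.diagonal t) =
      Matrix.diagonal fun k => Sum.elim t (-t) ((LocalSplitting.e₂ n).symm k) := by
  change Matrix.reindex _ _ (Matrix.fromBlocks (Matrix.diagonal t) 0 0 (-Matrix.diagonal t)) = _
  rw [Matrix.diagonal_neg, Matrix.fromBlocks_diagonal, Matrix.reindex_apply, Matrix.submatrix_diagonal_equiv]
  rfl

/-- The doubled Gram matrix of a product of diagonal forms `(diag a, diag b)`, in closed form: diagonal with entries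
`± a (e⁻¹ i).1 * b (e⁻¹ i).2`, `i = e₂⁻¹ k` (sign `+` on the first copy, `−` on the second).
[cite: HarrisKudlaSweet1996, §1 (1.9)] -/
theorem gramD_gram_diagonal (a : Fin N → F) (b : Fin M → F) :
    LocalSplitting.gramD F n (gram F e (Matrix.diagonal a) (Matrix.diagonal b)) =
      Matrix.diagonal fun k => Sum.elim (fun i => a (e.symm i).1 * b (e.symm i).2)
        (fun i => -(a (e.symm i).1 * b (e.symm i).2)) ((LocalSplitting.e₂ n).symm k) := by
  rw [gram_diagonal, gramD_diagonal]
  rfl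

end General

/-! ## §2. The CM datum of record: `T_V = diag(dV)`, `T_W = diag(dW)` over `L⁺` -/

section CM

variable (L : Type) [Field L] [NumberField L] [IsCMField L] {N M n : ℕ} (e : Fin N × Fin M ≃ Fin n)
  (dV : Fin N → L) (hdV : ∀ i, IsCMField.complexConj L (dV i) = dV i)
  (dW : Fin M → L) (hdW : ∀ i, IsCMField.complexConj L (dW i) = dW i)

/-- **`T^𝔻` of the CM datum is diagonal**: `gramD L⁺ n (gram L⁺ e (diag dV) (diag dW)) = diag (t₀ ⊕ (−t₀) ∘ e₂⁻¹)` with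
`t₀ = cmGramEntry L e dV dW` — the input `hTd : T = diagonal t₀^𝔻` of the diagonal-frame archimedean files.
[cite: HarrisKudlaSweet1996, §1 (1.9)] -/
theorem gramD_gram_realDiagonal :
    LocalSplitting.gramD (↥(maximalRealSubfield L)) n (gram _ e (realDiagonal L dV hdV) (realDiagonal L dW hdW)) =
      Matrix.diagonal fun k => Sum.elim (cmGramEntry L e dV hdV dW hdW) (-cmGramEntry L e dV hdV dW hdW)
        ((LocalSplitting.e₂ n).symm k) := by
  rw [gram_realDiagonal, gramD_diagonal]

/-- The entries of `t₀^𝔻 = (t₀ ⊕ (−t₀)) ∘ e₂⁻¹` are non-zero when all `dV i ≠ 0`, `dW j ≠ 0` — the input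
`ht0 : ∀ k, t₀^𝔻 k ≠ 0`. [cite: HarrisKudlaSweet1996, §1 (1.9)] -/
theorem gramD_gram_realDiagonal_entry_ne_zero (hdV0 : ∀ i, dV i ≠ 0) (hdW0 : ∀ i, dW i ≠ 0) (k : Fin (n + n)) :
    Sum.elim (cmGramEntry L e dV hdV dW hdW) (-cmGramEntry L e dV hdV dW hdW) ((LocalSplitting.e₂ n).symm k) ≠ 0 := by
  rcases (LocalSplitting.e₂ n).symm k with i | i
  · exact cmGramEntry_ne_zero L e dV hdV dW hdW hdV0 hdW0 i
  · exact neg_ne_zero.2 (cmGramEntry_ne_zero L e dV hdV dW hdW hdV0 hdW0 i)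

/-- The values in `L` of the entries of `t₀^𝔻`: `dV_{(e⁻¹i).1} · dW_{(e⁻¹i).2}` on the first copy, its negative on the
second (`i = e₂⁻¹ k`). [cite: HarrisKudlaSweet1996, §1 (1.9)] -/
theorem gramD_gram_realDiagonal_entry_coe (k : Fin (n + n)) :
    ((Sum.elim (cmGramEntry L e dV hdV dW hdW) (-cmGramEntry L e dV hdV dW hdW) ((LocalSplitting.e₂ n).symm k) :
        ↥(maximalRealSubfield L)) : L) =
      Sum.elim (fun i => dV (e.symm i).1 * dW (e.symm i).2) (fun i => -(dV (e.symm i).1 * dW (e.symm i).2))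
        ((LocalSplitting.e₂ n).symm k) := by
  rcases (LocalSplitting.e₂ n).symm k with i | i
  · exact coe_cmGramEntry L e dV hdV dW hdW i
  · simp only [Sum.elim_inr, Pi.neg_apply]
    rw [← coe_cmGramEntry L e dV hdV dW hdW i]
    rfl

/-- The diagonal of `T^𝔻` of the CM datum is `t₀^𝔻` (so `T^𝔻 = diagonal (diag T^𝔻)` as well).
[cite: HarrisKudlaSweet1996, §1 (1.9)] -/
theorem diag_gramD_gram_realDiagonal :
    Matrix.diag (LocalSplitting.gramD (↥(maximalRealSubfield L)) n
        (gram _ e (realDiagonal L dV hdV) (realDiagonal L dW hdW))) =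
      fun k => Sum.elim (cmGramEntry L e dV hdV dW hdW) (-cmGramEntry L e dV hdV dW hdW)
        ((LocalSplitting.e₂ n).symm k) := by
  rw [gramD_gram_realDiagonal, Matrix.diag_diagonal]

end CM

end Literature.NumberTheory.GelbartRogawski1991.UnitaryDualPair
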